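import Literature.NumberTheory.EllipticCurves.BoxerDiao2010.TamagawaTwistLocalProofs
import HarnessLib

/-!
# The local index for type `I₀*` over a Henselian ring: `c = 1 + #{roots of the Step-6 cubic}` (proof)

`Proofs` file (theorems only: no definition, no named fact, no instance), topic
`Literature/NumberTheory/EllipticCurves`, sequel of `NeronComponentIndexTypeI0starProofs.lean`
(`c_v ∈ {1, 2, 4}` for type `I₀*`, Hensel-free) and `LocalIndexIstarFormParityProofs.lean`
(no root ⇒ `c = 1`; a simple root ⇒ `2 ∣ c`, over a Henselian ring).

This file proves the **printed exact alternative** of Silverman, *ATAEC*, IV.9.4 Step 6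
(PDF p. 345): "Type `I₀*` … `c = 1 + #{α ∈ k : P(α) = 0}`", stated — as in the source and as in
the tree's `NeronComponentIndexTypeIVExact.lean` — RELATIVE TO A NORMAL FORM and over a
HENSELIAN discrete valuation ring `R` (the printed setting is a complete field, *ATAEC* IV.9
p. 339 and Rem. IV.9.3: over a complete or Henselian `K` the group of components of the Néron
model IS `E(K)/E₀(K)`):

* `LocalIndex.finite_quotient_and_natCard_le_of_normalForm_Istar` — (Hensel-free, any DVR) for
  `J` over `R` with `a₁ = ϖα`, `a₂ = ϖβ`, `a₃ = ϖ²γ`, `a₄ = ϖ²δ`, `a₆ = ϖ³ε` whose cubic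
  `P̄(T) = T³ + β̄T² + δ̄T + ε̄` has only SIMPLE roots in the residue field `k`, the quotient
  `E(K)/E₀(K)` is finite of order `≤ 1 + #{t ∈ k : P̄(t) = 0}` (the root map of the tree's
  `index_mem_of_normalForm_Istar_zero` embeds the non-zero classes into the `k`-roots: a bad point
  is `(ϖx₁, ϖ²y₂)` with `P̄(x̄₁) = 0`, `exists_root_of_not_hasNonsingularReduction`, and two bad
  points over the same simple root are congruent, `hasNonsingularReduction_add_of_same_root`);
* `LocalIndex.exists_root_lift_cubic` — Hensel: a simple root `t ∈ k` of `P̄` lifts to a root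
  `T₀ ∈ R` of `T³ + βT² + δT + ε` with `T̄₀ = t`;
* `LocalIndex.index_eq_one_add_card_roots_of_normalForm_Istar_zero` — (Henselian `R`,
  `a₁ = a₃ = 0`) **`[E(K) : E₀(K)] = 1 + #{t ∈ k : P̄(t) = 0}`**: for each root `t`, the lifted
  point `T_t = (ϖT₀, 0) ∈ J(K)` is bad (`not_hasNonsingularReduction_some`), `−T_t = T_t`, and for
  two distinct roots the chord through `T_t, T_{t'}` is the `x`-axis, so
  `T_t − T_{t'} = T_t + T_{t'} = (−a₂ − ϖT₀ − ϖT₀', 0)` has both coordinates in `𝔪` and is bad as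
  well: the classes `0, [T_t]` are pairwise distinct, `1 + #roots ≤ #(E(K)/E₀(K))`;
* `LocalIndex.localTamagawaNumber_baseChange_eq_one_add_card_roots` — the same for the local
  Tamagawa number `c(N ⊗ K)` of a MINIMAL `R`-model `N` in that shape
  (`localTamagawaNumber_baseChange_eq_index`), with the simplicity of the roots supplied by the
  non-vanishing of the discriminant `β̄²δ̄² − 4δ̄³ − 4β̄³ε̄ − 27ε̄² + 18β̄δ̄ε̄` of `P̄`
  (`cubicDiscr_eq_zero_of_double_root`).

The shape `a₁ = a₃ = 0` is the one met by the quadratic twist `y² = x³ + dB₂x² + d²B₄x + d³B₆`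
at an odd prime `ϖ ∥ d` (Boxer–Diao 2010, proof of Prop. 4.1, p. 1977: "`c_p` is equal to `1`
plus the number of roots of the polynomial … mod `p`"; Kramer 1981, Prop. 3), which is the use
made of it in the tree (Tamagawa numbers of Heegner door twists at `2`).

## References

* J. H. Silverman, *Advanced Topics in the Arithmetic of Elliptic Curves*, GTM 151, Springer
  1994, IV.9 (setting, PDF p. 339), Rem. IV.9.3 (PDF p. 341), IV.9.4 Step 6 (PDF p. 345) and
  its proof (PDF pp. 350–352; Table 4.1: component group `(ℤ/2ℤ)²`). [SilvermanATAEC1994]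
* J. Tate, *Algorithm for determining the type of a singular fiber in an elliptic pencil*,
  LNM 476 (1975), §7 case 6). [Tate1975]
* G. Boxer, P. Diao, *2-Selmer groups of quadratic twists of elliptic curves*, Proc. Amer. Math.
  Soc. 138 (2010) 1969–1978, proof of Prop. 4.1 (p. 1977). [BoxerDiao2010]

## Design

Theorems only; no definition, no named fact, no `sorry`. The uniformiser `ϖ` is ANY irreducible
element; `[HenselianLocalRing R]` appears only where Hensel is used. The number of roots is
`(P̄.roots).toFinset.card` for the explicit polynomial `X³ + C β̄ X² + C δ̄ X + C ε̄` over the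
residue field (no finiteness of the residue field is assumed).
-/

noncomputable section

open scoped Classical

open IsLocalRing Polynomial

namespace Literature.NumberTheory.EllipticCurves

namespace LocalIndex

variable {R : Type*} [CommRing R] [IsDomain R] [IsDiscreteValuationRing R]
  {K : Type*} [Field K] [Algebra R K] [IsFractionRing R K]

/-! ### The upper bound `#(E(K)/E₀(K)) ≤ 1 + #roots` (no Hensel) -/

/-- **`E(K)/E₀(K)` is finite of order `≤ 1 + #{t ∈ k : P̄(t) = 0}`** for the `I₀*`-shaped normal
form `a₁ = ϖα`, `a₂ = ϖβ`, `a₃ = ϖ²γ`, `a₄ = ϖ²δ`, `a₆ = ϖ³ε` whose cubic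
`P̄ = T³ + β̄T² + δ̄T + ε̄` has only simple roots in the residue field: the root map
`[(ϖx₁, ϖ²y₂)] ↦ x̄₁` embeds the non-zero classes into the `k`-roots of `P̄` (Silverman, *ATAEC*,
IV.9.4, proof of Step 6, PDF pp. 350–352; the tree's `index_mem_of_normalForm_Istar_zero` with the
bound made explicit). [cite: SilvermanATAEC1994, IV.9.4 Step 6 (PDF p. 345)] -/
theorem finite_quotient_and_natCard_le_of_normalForm_Istar (J : WeierstrassCurve R)
    {ϖ α β γ δ ε : R} (hϖ : Irreducible ϖ) (hα : J.a₁ = ϖ * α) (hβ : J.a₂ = ϖ * β)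
    (hγ : J.a₃ = ϖ ^ 2 * γ) (hδ : J.a₄ = ϖ ^ 2 * δ) (hε : J.a₆ = ϖ ^ 3 * ε)
    (hsimple : ∀ r : ResidueField R,
      r ^ 3 + residue R β * r ^ 2 + residue R δ * r + residue R ε = 0 →
        3 * r ^ 2 + 2 * residue R β * r + residue R δ ≠ 0) :
    Finite ((J.baseChange K).toAffine.Point ⧸
        J.nonsingularReductionSubgroup (integers_valuationRing_valuation R K)) ∧
      Nat.card ((J.baseChange K).toAffine.Point ⧸
          J.nonsingularReductionSubgroup (integers_valuationRing_valuation R K)) ≤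
        1 + (X ^ 3 + C (residue R β) * X ^ 2 + C (residue R δ) * X + C (residue R ε) :
          (ResidueField R)[X]).roots.toFinset.card := by
  set H := J.nonsingularReductionSubgroup (integers_valuationRing_valuation R K) with hH
  set f : (ResidueField R)[X] := X ^ 3 + C (residue R β) * X ^ 2 + C (residue R δ) * X +
    C (residue R ε) with hf
  have hf0 : f ≠ 0 := by
    have hm : f.Monic := by rw [hf]; monicity!
    exact hm.ne_zero
  have hfeval : ∀ r, f.eval r = r ^ 3 + residue R β * r ^ 2 + residue R δ * r + residue R ε := by
    intro r; simp [hf]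
  set S : Finset (ResidueField R) := f.roots.toFinset with hS
  have hmemS : ∀ r, r ∈ S ↔ r ^ 3 + residue R β * r ^ 2 + residue R δ * r + residue R ε = 0 := by
    intro r
    rw [hS, Multiset.mem_toFinset, Polynomial.mem_roots hf0, Polynomial.IsRoot.def, hfeval]
  -- bad points: coordinates and roots
  have hbad : ∀ P : (J.baseChange K).toAffine.Point, ¬ J.HasNonsingularReduction P →
      ∃ (x₁ y₂ : R) (h : (J.baseChange K).toAffine.Nonsingular (algebraMap R K (ϖ * x₁))
        (algebraMap R K (ϖ ^ 2 * y₂))), P = .some _ _ h ∧ residue R x₁ ∈ S := by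
    intro P hP
    obtain ⟨x₁, y₂, h, rfl, hid⟩ :=
      exists_root_of_not_hasNonsingularReduction J hϖ hα hβ hγ hδ hε hP
    refine ⟨x₁, y₂, h, rfl, (hmemS _).mpr ?_⟩
    have := congrArg (residue R) hid
    simpa [(residue_eq_zero_iff _).mpr ((IsLocalRing.mem_maximalIdeal _).mpr hϖ.not_isUnit)]
      using this
  choose! fx fy fh hPeq' hroot using hbad
  -- two bad points over the same root are congruent modulo `H`
  have hcongr : ∀ P Q : (J.baseChange K).toAffine.Point, ¬ J.HasNonsingularReduction P →
      ¬ J.HasNonsingularReduction Q → residue R (fx P) = residue R (fx Q) → P - Q ∈ H := by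
    intro P Q hP hQ hPQ
    rw [hPeq' P hP, hPeq' Q hQ, sub_eq_add_neg, WeierstrassCurve.Affine.Point.neg_some]
    have hneg : (J.baseChange K).toAffine.negY (algebraMap R K (ϖ * fx Q))
        (algebraMap R K (ϖ ^ 2 * fy Q)) =
          algebraMap R K (ϖ ^ 2 * (-fy Q - α * fx Q - γ)) := by
      rw [WeierstrassCurve.Affine.negY]
      simp only [WeierstrassCurve.baseChange, WeierstrassCurve.map_a₁, WeierstrassCurve.map_a₃,
        hα, hγ, map_neg, map_sub, map_mul, map_pow]
      ring
    rw [point_some_congr rfl hneg (h' := hneg ▸ (WeierstrassCurve.Affine.nonsingular_neg _ _).mpr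
      (fh Q hQ))]
    rw [hH, WeierstrassCurve.mem_nonsingularReductionSubgroup_iff]
    exact hasNonsingularReduction_add_of_same_root J hϖ hα hβ hγ hδ hε hPQ
      (hsimple _ ((hmemS _).mp (hroot P hP))) (fh P hP) _
  -- the root map on the quotient is injective
  set Q := (J.baseChange K).toAffine.Point ⧸ H with hQ
  let F : Q → Option S := fun q =>
    if hq : J.HasNonsingularReduction q.out then none
    else some ⟨residue R (fx q.out), hroot _ hq⟩
  have hF : Function.Injective F := by
    intro q q' hqq'
    simp only [F] at hqq'
    by_cases hq : J.HasNonsingularReduction q.out <;>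
      by_cases hq' : J.HasNonsingularReduction q'.out
    · rw [← QuotientAddGroup.out_eq' q, ← QuotientAddGroup.out_eq' q',
        (QuotientAddGroup.eq_zero_iff _).mpr
          ((WeierstrassCurve.mem_nonsingularReductionSubgroup_iff _).mpr hq),
        (QuotientAddGroup.eq_zero_iff _).mpr
          ((WeierstrassCurve.mem_nonsingularReductionSubgroup_iff _).mpr hq')]
    · rw [dif_pos hq, dif_neg hq'] at hqq'; exact absurd hqq' (Option.some_ne_none _).symm
    · rw [dif_neg hq, dif_pos hq'] at hqq'; exact absurd hqq' (Option.some_ne_none _)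
    · rw [dif_neg hq, dif_neg hq', Option.some_inj, Subtype.mk.injEq] at hqq'
      rw [← QuotientAddGroup.out_eq' q, ← QuotientAddGroup.out_eq' q',
        QuotientAddGroup.eq_iff_sub_mem]
      exact hcongr _ _ hq hq' hqq'
  haveI : Finite Q := Finite.of_injective F hF
  refine ⟨this, ?_⟩
  refine (Nat.card_le_card_of_injective F hF).trans ?_
  rw [Nat.card_eq_fintype_card, Fintype.card_option, Fintype.card_coe]
  omega

/-! ### Hensel: a simple residual root of the Step-6 cubic lifts -/

omit [IsDomain R] [IsDiscreteValuationRing R] in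
/-- **Hensel for the Step-6 cubic.** Over a Henselian local ring, a root `t ∈ k` of
`T³ + β̄T² + δ̄T + ε̄` with `3t² + 2β̄t + δ̄ ≠ 0` lifts to `T₀ ∈ R` with `T₀³ + βT₀² + δT₀ + ε = 0`
and `T̄₀ = t` (`HenselianLocalRing.is_henselian` on the monic cubic; Silverman, *ATAEC*, IV.9.4,
proof of Step 6: the components over the `k`-rational roots are defined over `k`).
[cite: SilvermanATAEC1994, IV.9.4 Step 6 (PDF p. 345)] -/
theorem exists_root_lift_cubic [HenselianLocalRing R] (β δ ε : R) {t : ResidueField R}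
    (ht : t ^ 3 + residue R β * t ^ 2 + residue R δ * t + residue R ε = 0)
    (ht' : 3 * t ^ 2 + 2 * residue R β * t + residue R δ ≠ 0) :
    ∃ T₀ : R, T₀ ^ 3 + β * T₀ ^ 2 + δ * T₀ + ε = 0 ∧ residue R T₀ = t := by
  obtain ⟨t₀, ht₀⟩ := residue_surjective t
  set f : Polynomial R := Polynomial.X ^ 3 + Polynomial.C β * Polynomial.X ^ 2 +
    Polynomial.C δ * Polynomial.X + Polynomial.C ε with hf
  have hfm : f.Monic := by rw [hf]; monicity!
  have hev : ∀ s : R, f.eval s = s ^ 3 + β * s ^ 2 + δ * s + ε := by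
    intro s; simp only [hf, Polynomial.eval_add, Polynomial.eval_mul, Polynomial.eval_C,
      Polynomial.eval_pow, Polynomial.eval_X]
  have hev' : ∀ s : R, f.derivative.eval s = 3 * s ^ 2 + 2 * β * s + δ := by
    intro s
    simp [hf]
    ring
  have h₁ : f.eval t₀ ∈ maximalIdeal R := by
    rw [← residue_eq_zero_iff, hev]
    simp only [map_add, map_mul, map_pow, ht₀]
    exact ht
  have h₂ : IsUnit (f.derivative.eval t₀) := by
    rw [← residue_ne_zero_iff_isUnit, hev']
    simp only [map_add, map_mul, map_pow, map_ofNat, ht₀]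
    exact ht'
  obtain ⟨T₀, hT₀, hT₀t⟩ := HenselianLocalRing.is_henselian f hfm t₀ h₁ h₂
  refine ⟨T₀, by rw [← hev]; exact hT₀, ?_⟩
  rw [← ht₀, ← sub_eq_zero, ← map_sub, residue_eq_zero_iff]; exact hT₀t

/-! ### The exact index `[E(K) : E₀(K)] = 1 + #roots` (Henselian, `a₁ = a₃ = 0`) -/

/-- **`[E(K) : E₀(K)] = 1 + #{t ∈ k : P̄(t) = 0}` for the `I₀*`-shaped normal form
`y² = x³ + ϖβx² + ϖ²δx + ϖ³ε` over a Henselian DVR** (`Δ ≠ 0`, only simple roots of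
`P̄ = T³ + β̄T² + δ̄T + ε̄` in the residue field `k`): Silverman, *ATAEC*, IV.9.4 Step 6 (PDF
p. 345), "`c = 1 + #{α ∈ k : P(α) = 0}`". Upper bound: `finite_quotient_and_natCard_le_of_normalForm_Istar`.
Lower bound: each root `t` lifts (Hensel) to `T₀ ∈ R` with `T₀³ + βT₀² + δT₀ + ε = 0`, the point
`T_t = (ϖT₀, 0) ∈ J(K)` is bad (both coordinates in `𝔪`) with `−T_t = T_t`, and for `t ≠ t'` the
chord is `y = 0`, so `T_t − T_{t'} = T_t + T_{t'} = (−ϖ(β + T₀ + T₀'), 0)` is bad as well: the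
classes `0, [T_t]` (`t` a root) are pairwise distinct.
[cite: SilvermanATAEC1994, IV.9.4 Step 6 (PDF p. 345) with Rem. IV.9.3 (PDF p. 341)] -/
theorem index_eq_one_add_card_roots_of_normalForm_Istar_zero [HenselianLocalRing R]
    (J : WeierstrassCurve R) {ϖ β δ ε : R} (hϖ : Irreducible ϖ) (h1 : J.a₁ = 0)
    (hβ : J.a₂ = ϖ * β) (h3 : J.a₃ = 0) (hδ : J.a₄ = ϖ ^ 2 * δ) (hε : J.a₆ = ϖ ^ 3 * ε)
    (hΔ : J.Δ ≠ 0)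
    (hsimple : ∀ r : ResidueField R,
      r ^ 3 + residue R β * r ^ 2 + residue R δ * r + residue R ε = 0 →
        3 * r ^ 2 + 2 * residue R β * r + residue R δ ≠ 0) :
    (J.nonsingularReductionSubgroup (integers_valuationRing_valuation R K)).index =
      1 + (X ^ 3 + C (residue R β) * X ^ 2 + C (residue R δ) * X + C (residue R ε) :
          (ResidueField R)[X]).roots.toFinset.card := by
  have hα : J.a₁ = ϖ * 0 := by rw [h1, mul_zero]
  have hγ : J.a₃ = ϖ ^ 2 * 0 := by rw [h3, mul_zero]
  obtain ⟨hfin, hle⟩ :=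
    finite_quotient_and_natCard_le_of_normalForm_Istar (K := K) J hϖ hα hβ hγ hδ hε hsimple
  set H := J.nonsingularReductionSubgroup (integers_valuationRing_valuation R K) with hH
  set Q := (J.baseChange K).toAffine.Point ⧸ H with hQ
  haveI : Finite Q := hfin
  set f : (ResidueField R)[X] := X ^ 3 + C (residue R β) * X ^ 2 + C (residue R δ) * X +
    C (residue R ε) with hf
  have hf0 : f ≠ 0 := by
    have hm : f.Monic := by rw [hf]; monicity!
    exact hm.ne_zero
  have hfeval : ∀ r, f.eval r = r ^ 3 + residue R β * r ^ 2 + residue R δ * r + residue R ε := by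
    intro r; simp [hf]
  set S : Finset (ResidueField R) := f.roots.toFinset with hS
  have hmemS : ∀ r, r ∈ S ↔ r ^ 3 + residue R β * r ^ 2 + residue R δ * r + residue R ε = 0 := by
    intro r
    rw [hS, Multiset.mem_toFinset, Polynomial.mem_roots hf0, Polynomial.IsRoot.def, hfeval]
  rw [AddSubgroup.index_eq_card]
  refine le_antisymm hle ?_
  -- basic facts
  have hϖ0 : ϖ ≠ 0 := hϖ.ne_zero
  have hinj := IsFractionRing.injective R K
  have hm : ϖ ∈ maximalIdeal R := (IsLocalRing.mem_maximalIdeal _).mpr hϖ.not_isUnit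
  have h3m : J.a₃ ∈ maximalIdeal R := by rw [h3]; exact zero_mem _
  have h4m : J.a₄ ∈ maximalIdeal R :=
    hδ ▸ Ideal.mul_mem_right _ _ (Ideal.pow_mem_of_mem _ hm 2 two_pos)
  have hΔK : (J.baseChange K).Δ ≠ 0 := by
    rw [WeierstrassCurve.baseChange, WeierstrassCurve.map_Δ]
    exact (map_ne_zero_iff _ hinj).mpr hΔ
  have ha1K : (J.baseChange K).a₁ = 0 := by
    simp only [WeierstrassCurve.baseChange, WeierstrassCurve.map_a₁, h1, map_zero]
  have ha3K : (J.baseChange K).a₃ = 0 := by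
    simp only [WeierstrassCurve.baseChange, WeierstrassCurve.map_a₃, h3, map_zero]
  have ha2K : (J.baseChange K).a₂ = algebraMap R K (ϖ * β) := by
    simp only [WeierstrassCurve.baseChange, WeierstrassCurve.map_a₂, hβ]
  -- Hensel lifts of the roots
  have hlift : ∀ r : S, ∃ T₀ : R, T₀ ^ 3 + β * T₀ ^ 2 + δ * T₀ + ε = 0 ∧ residue R T₀ = r :=
    fun r => exists_root_lift_cubic β δ ε ((hmemS _).mp r.2) (hsimple _ ((hmemS _).mp r.2))
  choose e he hres using hlift
  -- the points `T_r = (ϖ e_r, 0)`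
  have hns : ∀ r : S, (J.baseChange K).toAffine.Nonsingular (algebraMap R K (ϖ * e r))
      (algebraMap R K 0) := by
    intro r
    have heqR : J.toAffine.Equation (ϖ * e r) 0 := by
      rw [WeierstrassCurve.Affine.equation_iff, h1, hβ, h3, hδ, hε]
      linear_combination -(ϖ ^ 3) * he r
    have heq : (J.baseChange K).toAffine.Equation (algebraMap R K (ϖ * e r))
        (algebraMap R K 0) :=
      (WeierstrassCurve.Affine.map_equation _ hinj _ _).mpr heqR
    exact ((J.baseChange K).toAffine.equation_iff_nonsingular_of_Δ_ne_zero hΔK).mp heq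
  set T : S → (J.baseChange K).toAffine.Point := fun r => .some _ _ (hns r) with hT
  have hTbad : ∀ r : S, T r ∉ H := by
    intro r
    rw [hH, WeierstrassCurve.mem_nonsingularReductionSubgroup_iff, hT]
    exact not_hasNonsingularReduction_some J h3m h4m (Ideal.mul_mem_right _ _ hm) (zero_mem _)
      (hns r)
  -- `-T_r = T_r`
  have hTneg : ∀ r : S, -T r = T r := by
    intro r
    rw [hT, WeierstrassCurve.Affine.Point.neg_some]
    refine point_some_congr rfl ?_
    rw [WeierstrassCurve.Affine.negY, ha1K, ha3K, map_zero]
    ring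
  -- `T_r + T_{r'}` is bad for `r ≠ r'`
  have hTadd : ∀ r r' : S, r ≠ r' → T r + T r' ∉ H := by
    intro r r' hrr'
    have hee : e r ≠ e r' := by
      intro h
      apply hrr'
      apply Subtype.ext
      rw [← hres r, ← hres r', h]
    have hx : algebraMap R K (ϖ * e r) ≠ algebraMap R K (ϖ * e r') := by
      intro h
      exact hee (mul_left_cancel₀ hϖ0 (hinj h))
    rw [hT]
    simp only
    rw [WeierstrassCurve.Affine.Point.add_of_X_ne hx]
    have hslope : (J.baseChange K).toAffine.slope (algebraMap R K (ϖ * e r))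
        (algebraMap R K (ϖ * e r')) (algebraMap R K 0) (algebraMap R K 0) = 0 := by
      rw [WeierstrassCurve.Affine.slope_of_X_ne hx, sub_self, zero_div]
    have hX : (J.baseChange K).toAffine.addX (algebraMap R K (ϖ * e r))
        (algebraMap R K (ϖ * e r')) ((J.baseChange K).toAffine.slope (algebraMap R K (ϖ * e r))
        (algebraMap R K (ϖ * e r')) (algebraMap R K 0) (algebraMap R K 0)) =
          algebraMap R K (ϖ * (-β - e r - e r')) := by
      rw [hslope, WeierstrassCurve.Affine.addX, ha1K, ha2K]
      simp only [map_mul, map_sub, map_neg]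
      ring
    have hY : (J.baseChange K).toAffine.addY (algebraMap R K (ϖ * e r))
        (algebraMap R K (ϖ * e r')) (algebraMap R K 0)
        ((J.baseChange K).toAffine.slope (algebraMap R K (ϖ * e r))
          (algebraMap R K (ϖ * e r')) (algebraMap R K 0) (algebraMap R K 0)) =
          algebraMap R K 0 := by
      rw [WeierstrassCurve.Affine.addY, WeierstrassCurve.Affine.negAddY, WeierstrassCurve.Affine.negY,
        hslope, ha1K, ha3K, map_zero]
      ring
    have h' : (J.baseChange K).toAffine.Nonsingular (algebraMap R K (ϖ * (-β - e r - e r')))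
        (algebraMap R K 0) := by
      have := WeierstrassCurve.Affine.nonsingular_add (hns r) (hns r') fun hxy => hx hxy.left
      rw [hX, hY] at this
      exact this
    rw [point_some_congr hX hY (h' := h'), hH, WeierstrassCurve.mem_nonsingularReductionSubgroup_iff]
    exact not_hasNonsingularReduction_some J h3m h4m (Ideal.mul_mem_right _ _ hm) (zero_mem _) h'
  -- the injection `Option S → Q`
  let G : Option S → Q := fun o => match o with
    | none => 0
    | some r => QuotientAddGroup.mk (T r)
  have hG : Function.Injective G := by
    intro o o' hoo'
    match o, o' with
    | none, none => rfl
    | none, some r' =>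
      exfalso
      simp only [G] at hoo'
      exact hTbad r' ((QuotientAddGroup.eq_zero_iff _).mp hoo'.symm)
    | some r, none =>
      exfalso
      simp only [G] at hoo'
      exact hTbad r ((QuotientAddGroup.eq_zero_iff _).mp hoo')
    | some r, some r' =>
      simp only [G] at hoo'
      by_contra hne
      have hrr' : r ≠ r' := fun h => hne (by rw [h])
      apply hTadd r r' hrr'
      have hsub : T r - T r' ∈ H := (QuotientAddGroup.eq_iff_sub_mem).mp hoo'
      rwa [sub_eq_add_neg, hTneg r'] at hsub
  calc 1 + S.card = Nat.card (Option S) := by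
        rw [Nat.card_eq_fintype_card, Fintype.card_option, Fintype.card_coe]; omega
    _ ≤ Nat.card Q := Nat.card_le_card_of_injective G hG

/-- If the discriminant `β̄²δ̄² − 4δ̄³ − 4β̄³ε̄ − 27ε̄² + 18β̄δ̄ε̄` of `T³ + β̄T² + δ̄T + ε̄` is
non-zero, its roots in the residue field are simple (`cubicDiscr_eq_zero_of_double_root`).
[folklore] -/
private theorem cubic_roots_simple_of_discr_ne_zero {β δ ε : R}
    (hdisc : residue R β ^ 2 * residue R δ ^ 2 - 4 * residue R δ ^ 3 -
      4 * residue R β ^ 3 * residue R ε - 27 * residue R ε ^ 2 +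
        18 * residue R β * residue R δ * residue R ε ≠ 0) :
    ∀ r : ResidueField R,
      r ^ 3 + residue R β * r ^ 2 + residue R δ * r + residue R ε = 0 →
        3 * r ^ 2 + 2 * residue R β * r + residue R δ ≠ 0 :=
  fun _ hr hr' => hdisc (cubicDiscr_eq_zero_of_double_root hr hr')

/-- **`c(N ⊗ K) = 1 + #{t ∈ k : P̄(t) = 0}` for a MINIMAL `R`-model `N` in the shape
`y² = x³ + ϖβx² + ϖ²δx + ϖ³ε` over a Henselian DVR**, when the discriminant of
`P̄ = T³ + β̄T² + δ̄T + ε̄` is non-zero in the residue field (type `I₀*`): Silverman, *ATAEC*,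
IV.9.4 Step 6, "`c = 1 + #{α ∈ k : P(α) = 0}`"; Boxer–Diao 2010, proof of Prop. 4.1 (p. 1977):
"`c_p` is equal to `1` plus the number of roots of the polynomial … mod `p`". The local
Tamagawa number of the tree is the index on the minimal model
(`localTamagawaNumber_baseChange_eq_index`).
[cite: SilvermanATAEC1994, IV.9.4 Step 6 (PDF p. 345) with Rem. IV.9.3 (PDF p. 341)]
[cite: BoxerDiao2010, proof of Prop. 4.1 (p. 1977)] -/
theorem localTamagawaNumber_baseChange_eq_one_add_card_roots [HenselianLocalRing R]
    (N : WeierstrassCurve R) [(N.baseChange K).IsElliptic] [(N.baseChange K).IsMinimal R]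
    {ϖ β δ ε : R} (hϖ : Irreducible ϖ) (h1 : N.a₁ = 0) (hβ : N.a₂ = ϖ * β) (h3 : N.a₃ = 0)
    (hδ : N.a₄ = ϖ ^ 2 * δ) (hε : N.a₆ = ϖ ^ 3 * ε)
    (hdisc : residue R β ^ 2 * residue R δ ^ 2 - 4 * residue R δ ^ 3 -
      4 * residue R β ^ 3 * residue R ε - 27 * residue R ε ^ 2 +
        18 * residue R β * residue R δ * residue R ε ≠ 0) :
    (N.baseChange K).localTamagawaNumber R =
      1 + (X ^ 3 + C (residue R β) * X ^ 2 + C (residue R δ) * X + C (residue R ε) :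
          (ResidueField R)[X]).roots.toFinset.card := by
  have hΔ : N.Δ ≠ 0 := by
    intro h0
    apply (N.baseChange K).Δ'.ne_zero
    rw [WeierstrassCurve.coe_Δ', WeierstrassCurve.baseChange, WeierstrassCurve.map_Δ, h0, map_zero]
  rw [localTamagawaNumber_baseChange_eq_index N]
  exact index_eq_one_add_card_roots_of_normalForm_Istar_zero (J := N) hϖ h1 hβ h3 hδ hε hΔ
    (cubic_roots_simple_of_discr_ne_zero hdisc)

end LocalIndex

end Literature.NumberTheory.EllipticCurves

end
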